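import Literature.NumberTheory.EllipticCurves.ComplexMultiplicationShaIsogenyProofs
import Literature.NumberTheory.EllipticCurves.IsogenyLocalPointsMaps
import HarnessLib

/-!
# bsd.S28 (Rubin): finiteness of `Ш(E/ℚ)` for CM curves with `L(E,1) ≠ 0` — level 4:
# the isogeny step over `ℚ`, unconditionally

Fourth level of the decomposition of `Literature.NumberTheory.EllipticCurves.shaFinite_of_hasCM_of_L_one_ne_zero` (bsd.S28, `Ш`
part; Rubin, Invent. Math. 89 (1987), §0 Remark (3)). Level 3
(`ComplexMultiplicationShaIsogenyProofs.lean`) left, for the passage from CM by an arbitrary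
order to CM by the maximal order over `ℚ`, one geometric leaf: that the `ℚ`-isogeny `E → E'`
acts on local points (`WeierstrassCurve.Isogeny.hasLocalPointsMaps` over `ℚ`). The isogenies in
question are explicit — the table of `ComplexMultiplicationMaximalOrderProofs.lean`: Silverman's
`2`-isogenies for `j = 54000, 287496, 16581375`, Vélu's `3`-isogeny for `j = -12288000`,
transported along `j` by changes of variables and quadratic twists — and for each of these
generators the local points maps are **constructed** in `IsogenyLocalPointsMaps.lean`
(`isLocIsogenous_of_eq_twoIsogenyCodomain`, `IsVeluThreePair.isLocIsogenous`,
`isLocIsogenous_smul`/`isLocIsogenous_of_smul`, `IsLocIsogenous.quadraticTwist`, `.trans'`).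
Re-running the table with the relation `IsLocIsogenous` (an isogeny *with* local points maps)
therefore removes the leaf: `shaFinite_of_hasCM_of_L_one_ne_zero_of_level4` derives the target,
sorry-free, from the six printed statements

1. Rubin 1987, Thm. 6.6 for `E_K` (`Rubin1987_sha_torsionBy_eq_bot_cofinite`);
2. Rubin 1987, §10: `Ш(E_K/K)_{𝔭^∞}` finite (`Rubin1987_sha_primary_finite`);
3. Deuring, `L(E_K/K, s) = L(E/ℚ, s)²` (`Deuring_LFunction_baseChange_cmField`);
4. modularity (`hasEntireLFunction_rat`);
5. the classification of rational CM `j`-invariants (`hasCM_iff_j_mem`, Heegner–Baker–Stark);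
6. Knapp, Thm. 11.67 (`LFunction_eq_of_isIsogenous`),

all of Remark (3)'s reduction to Theorem A — base change to the CM field, Theorem A from its two
halves, the isogeny to maximal order *and* the isogeny invariance of the finiteness of `Ш`
along it (Milne, *ADT*, Lemma I.7.1(b): dual isogeny, `Ш[n]` finite, `Ш(φ)`) — being proved.

## Main statements

* `isLocIsogenous_cm12/16/28/27`: the four explicit isogenies with local points maps.
* `exists_isLocIsogenous_j_eq_of_j_eq`: transport along `j` (twists and changes of variables).
* `exists_isLocIsogenous_j_mem_maximalCMJInvariants_of_j_mem_nonmaximalCMJInvariants`: the table.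
* `exists_isLocIsogenous_j_mem_maximalCMJInvariants_of_hasCM_of_hasCM_iff_j_mem`: the `HasCM`
  form from `hasCM_iff_j_mem`.
* `shaFinite_of_hasCM_of_L_one_ne_zero_of_maximalOrder`: the `HasCM` form of bsd.S28 (`Ш` part)
  from its maximal-order case, Knapp 11.67 and `hasCM_iff_j_mem` — the isogeny step proved.
* `shaFinite_of_hasCM_of_L_one_ne_zero_of_level4`: the target from leaves 1–6.

## References

* K. Rubin, Invent. Math. 89 (1987), §0 Remark (3), §10 (p. 548: reduction to the maximal
  order by an isogeny). [Rubin1987Sha]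
* J. S. Milne, *Arithmetic Duality Theorems*, 2nd ed. (2006), Ch. I Lemma 7.1(b). [MilneADT2006]
* J. H. Silverman, *Advanced Topics in the Arithmetic of Elliptic Curves* (1994), II
  Exercise 2.12(b), App. A §3. [SilvermanAdvancedTopics1994]
* J. H. Silverman, *The Arithmetic of Elliptic Curves*, 2nd ed. (2009), III.4.5, X.5.4,
  C.11.3. [SilvermanAEC2009]
* J. E. Cremona, *Algorithms for Modular Elliptic Curves*, 2nd ed. (1997), §3.8–3.9.
  [CremonaAlgorithms1997]
-/

noncomputable section

open scoped Classical

open WeierstrassCurve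

namespace Literature.NumberTheory.EllipticCurves

/-! ## The four explicit isogenies, with local points maps -/

/-- `j = 54000 ~ j = 0` with local points maps (Silverman's `2`-isogeny).
[cite: SilvermanAEC2009, III.4 Example 4.5] -/
theorem isLocIsogenous_cm12 :
    IsLocIsogenous (⟨0, 6, 0, -3, 0⟩ : WeierstrassCurve ℚ) ⟨0, -12, 0, 48, 0⟩ :=
  isLocIsogenous_of_eq_twoIsogenyCodomain _ (by rw [twoIsogenyCodomain_mk]; norm_num)

/-- `j = 287496 ~ j = 1728` with local points maps. [cite: SilvermanAEC2009, III.4 Example 4.5] -/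
theorem isLocIsogenous_cm16 :
    IsLocIsogenous (⟨0, -6, 0, 1, 0⟩ : WeierstrassCurve ℚ) ⟨0, 12, 0, 32, 0⟩ :=
  isLocIsogenous_of_eq_twoIsogenyCodomain _ (by rw [twoIsogenyCodomain_mk]; norm_num)

/-- `j = 16581375 ~ j = -3375` with local points maps.
[cite: SilvermanAEC2009, III.4 Example 4.5] -/
theorem isLocIsogenous_cm28 :
    IsLocIsogenous (⟨0, -42, 0, -7, 0⟩ : WeierstrassCurve ℚ) ⟨0, 84, 0, 1792, 0⟩ :=
  isLocIsogenous_of_eq_twoIsogenyCodomain _ (by rw [twoIsogenyCodomain_mk]; norm_num)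

/-- `j = -12288000 ~ j = 0` with local points maps (Vélu's `3`-isogeny of the pair
`threeTorsionModel 6 (-4) → threeIsogenyCodomain 6 (-4)`). [folklore] -/
theorem isLocIsogenous_cm27 :
    IsLocIsogenous (threeTorsionModel (6 : ℚ) (-4)) (threeIsogenyCodomain (6 : ℚ) (-4)) :=
  (isVeluThreePair_threeTorsionModel
    (isElliptic_threeTorsionModel_cm27).isUnit.ne_zero).isLocIsogenous

/-! ## Transport along `j` and the table -/

/-- **Transport of an isogeny with local points maps along `j`** (the `IsLocIsogenous` form of
`exists_isIsogenous_j_eq_of_j_eq`): if `j(W) = j(E) ≠ 0, 1728` and `E ~ E'` with local points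
maps, then `W ~ E'^{(d)}` with local points maps for the `d` with `C • W = E^{(d)}`
(`exists_variableChange_eq_quadraticTwist_of_j_eq`), by `isLocIsogenous_smul` and
`IsLocIsogenous.quadraticTwist`. Silverman, *AEC*, X.5 Cor. 5.4.1; Cremona, *Algorithms*, §3.8.
[folklore] -/
theorem exists_isLocIsogenous_j_eq_of_j_eq {W E E' : WeierstrassCurve ℚ} [W.IsElliptic]
    [E.IsElliptic] [E'.IsElliptic] (hj : W.j = E.j) (h0 : E.j ≠ 0) (h1728 : E.j ≠ 1728)
    (hiso : IsLocIsogenous E E') :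
    ∃ (W' : WeierstrassCurve ℚ) (_ : W'.IsElliptic), IsLocIsogenous W W' ∧ W'.j = E'.j := by
  obtain ⟨d, hd, C, hC⟩ := exists_variableChange_eq_quadraticTwist_of_j_eq hj h0 h1728
  haveI := E'.isElliptic_quadraticTwist hd
  refine ⟨E'.quadraticTwist d, ‹_›, ?_, E'.j_quadraticTwist hd⟩
  have h1 : IsLocIsogenous W (C • W) := isLocIsogenous_smul W C
  rw [hC] at h1
  exact h1.trans' (hiso.quadraticTwist hd)

/-- **The table, with local points maps**: every elliptic curve over `ℚ` with
`j ∈ {54000, 287496, -12288000, 16581375}` is joined, by a `ℚ`-isogeny with local points maps,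
to one with `j ∈ maximalCMJInvariants` (the proof of
`exists_isIsogenous_j_mem_maximalCMJInvariants_of_j_mem_nonmaximalCMJInvariants_holds`, rerun
with `IsLocIsogenous`). [cite: SilvermanAdvancedTopics1994, Exercise 2.12(b) and App. A §3] -/
theorem exists_isLocIsogenous_j_mem_maximalCMJInvariants_of_j_mem_nonmaximalCMJInvariants
    (W : WeierstrassCurve ℚ) [W.IsElliptic] (hj : W.j ∈ nonmaximalCMJInvariants) :
    ∃ (W' : WeierstrassCurve ℚ) (_ : W'.IsElliptic),
      IsLocIsogenous W W' ∧ W'.j ∈ maximalCMJInvariants := by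
  simp only [nonmaximalCMJInvariants, Finset.mem_insert, Finset.mem_singleton] at hj
  rcases hj with hj | hj | hj | hj
  · -- `j = 54000 ~ 0`
    obtain ⟨W', hW', hiso, hjW'⟩ := exists_isLocIsogenous_j_eq_of_j_eq (W := W)
      (by rw [hj, j_cm12]) (by rw [j_cm12]; norm_num) (by rw [j_cm12]; norm_num) isLocIsogenous_cm12
    exact ⟨W', hW', hiso, by rw [hjW', j_cm12']; decide⟩
  · -- `j = 287496 ~ 1728`
    obtain ⟨W', hW', hiso, hjW'⟩ := exists_isLocIsogenous_j_eq_of_j_eq (W := W)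
      (by rw [hj, j_cm16]) (by rw [j_cm16]; norm_num) (by rw [j_cm16]; norm_num) isLocIsogenous_cm16
    exact ⟨W', hW', hiso, by rw [hjW', j_cm16']; decide⟩
  · -- `j = -12288000 ~ 0`
    haveI := isElliptic_threeIsogenyCodomain (m := (6 : ℚ)) (s := -4)
    obtain ⟨W', hW', hiso, hjW'⟩ := exists_isLocIsogenous_j_eq_of_j_eq (W := W)
      (E := threeTorsionModel (6 : ℚ) (-4)) (E' := threeIsogenyCodomain (6 : ℚ) (-4))
      (by rw [hj, j_threeTorsionModel_cm27]) (by rw [j_threeTorsionModel_cm27]; norm_num)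
      (by rw [j_threeTorsionModel_cm27]; norm_num) isLocIsogenous_cm27
    exact ⟨W', hW', hiso, by rw [hjW', j_threeIsogenyCodomain_cm27]; decide⟩
  · -- `j = 16581375 ~ -3375`
    obtain ⟨W', hW', hiso, hjW'⟩ := exists_isLocIsogenous_j_eq_of_j_eq (W := W)
      (by rw [hj, j_cm28]) (by rw [j_cm28]; norm_num) (by rw [j_cm28]; norm_num) isLocIsogenous_cm28
    exact ⟨W', hW', hiso, by rw [hjW', j_cm28']; decide⟩

/-- **The `HasCM` form, with local points maps**: given the classification `hasCM_iff_j_mem`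
(Silverman *AEC* C.11.3.1–2), every CM elliptic curve over `ℚ` is joined by a `ℚ`-isogeny
with local points maps to one with CM by the maximal order (identity if `j(E)` is already a
maximal-order value, the table otherwise). [cite: SilvermanAdvancedTopics1994, Exercise 2.12(b)]
[cite: SilvermanAEC2009, App. C §11, Example C.11.3.1–3.2] -/
theorem exists_isLocIsogenous_j_mem_maximalCMJInvariants_of_hasCM_of_hasCM_iff_j_mem
    (h13 : hasCM_iff_j_mem) (W : WeierstrassCurve ℚ) [W.IsElliptic] (hCM : W.HasCM) :
    ∃ (W' : WeierstrassCurve ℚ) (_ : W'.IsElliptic),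
      IsLocIsogenous W W' ∧ W'.j ∈ maximalCMJInvariants := by
  by_cases hmax : W.j ∈ maximalCMJInvariants
  · exact ⟨W, ‹W.IsElliptic›, IsLocIsogenous.refl W, hmax⟩
  · exact exists_isLocIsogenous_j_mem_maximalCMJInvariants_of_j_mem_nonmaximalCMJInvariants W
      (mem_nonmaximalCMJInvariants_iff.2 ⟨(h13 W).1 hCM, hmax⟩)

/-! ## Assembly -/

/-- **bsd.S28 (`Ш` part), `HasCM` form, from its maximal-order case — the isogeny step
proved.** For `E/ℚ` with CM and `L(E/ℚ, 1) ≠ 0`: by `hasCM_iff_j_mem` (`h13`) and the explicit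
table, `E` is joined by a `ℚ`-isogeny `φ` *with local points maps* to `E'` with CM by `𝓞_K`;
`L(E', 1) = L(E, 1) ≠ 0` (`hR2`, Knapp 11.67); `Ш(E'/ℚ)` is finite by the maximal-order case
(`h9`); hence `Ш(E/ℚ)` is finite, `Ш(φ)` having finite kernel
(`IsLocIsogenous.shaFinite_of_shaFinite`: dual isogeny, `Ш[deg φ]` finite, functoriality of `Ш`
— all proved). This is Rubin's reduction (1987, §10, p. 548) over `ℚ` with Milne's
Lemma I.7.1(b) fully discharged for the isogenies that occur.
[cite: Rubin1987Sha, §0 Remark (3) and §10, p. 548] [cite: MilneADT2006, Ch. I Lemma 7.1(b)] -/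
theorem shaFinite_of_hasCM_of_L_one_ne_zero_of_maximalOrder
    (h9 : shaFinite_of_j_mem_maximalCMJInvariants_of_L_one_ne_zero)
    (h13 : hasCM_iff_j_mem) (hR2 : LFunction_eq_of_isIsogenous) :
    shaFinite_of_hasCM_of_L_one_ne_zero := by
  intro W _ hCM hL
  obtain ⟨W', hW', hiso, hj⟩ :=
    exists_isLocIsogenous_j_mem_maximalCMJInvariants_of_hasCM_of_hasCM_iff_j_mem h13 W hCM
  haveI := hW'
  have hL' : W'.entireLFunction 1 ≠ 0 := by
    rwa [← entireLFunction_eq_of_isIsogenous hR2 hiso.isIsogenous]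
  exact hiso.shaFinite_of_shaFinite (h9 W' hj hL')

/-- **bsd.S28 (`Ш` part) after four levels of decomposition.**
`shaFinite_of_hasCM_of_L_one_ne_zero` (`E/ℚ` with CM and `L(E/ℚ, 1) ≠ 0 ⇒ Ш(E/ℚ)` finite;
Rubin 1987, §0 Remark (3)) follows, sorry-free, from six printed statements: Rubin's
Theorem 6.6 (`h66`) and §10 (`h10`) for `E_K` (the two halves of Theorem A), Deuring's theorem
(`hD`), modularity (`hmod`), the classification of rational CM `j`-invariants (`h13`) and Knapp's
Thm. 11.67 (`hR2`). Proved in the tree along the way: Theorem A from its halves, Remark (3)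
from Theorem A (base change to the CM field, `Ш(E/ℚ) → Ш(E_K/K)` with finite kernel), the
explicit isogenies to maximal order with their local points maps, and the isogeny invariance
of the finiteness of `Ш` along them (Milne I.7.1(b)).
[cite: Rubin1987Sha, Thm. A, §0 Remark (3), Thm. 6.6 and §10]
[cite: MilneADT2006, Ch. I Lemma 7.1(b)] -/
theorem shaFinite_of_hasCM_of_L_one_ne_zero_of_level4
    (h66 : Rubin1987_sha_torsionBy_eq_bot_cofinite) (h10 : Rubin1987_sha_primary_finite)
    (hD : Deuring_LFunction_baseChange_cmField) (hmod : hasEntireLFunction_rat)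
    (h13 : hasCM_iff_j_mem) (hR2 : LFunction_eq_of_isIsogenous) :
    shaFinite_of_hasCM_of_L_one_ne_zero :=
  shaFinite_of_hasCM_of_L_one_ne_zero_of_maximalOrder
    (shaFinite_of_j_mem_maximalCMJInvariants_of_L_one_ne_zero_of_facts
      (Rubin1987_shaFinite_baseChange_cmField_of_level2 h66 h10) hD hmod)
    h13 hR2

end Literature.NumberTheory.EllipticCurves

end
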